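import Summits.QuantumFields.YangMills.Theorems.BalabanUVNodesK1AxV11Roads
import Summits.QuantumFields.YangMills.Theses.BalabanUVNodes

/-!
# K1ᴬ v11.1 — THE SIX REGISTERED STUB TEXTS AS NAMED PROPOSITIONS AND THE TWO BY-NAME CONCLUDERS OVER THE TREE MIRROR (`…K1AxV11Defs` ∕ `…K1AxV11Roads`) — the K1ᴬ analogue of
# dag-n16-e's `K3AxV8StubTexts`: a lane that proves `Stub1TextVW` ∕ `Stub2TextVW` ∕ `Stub3TextVW` (LINE 2′) or `Stub1Text` ∕ `Stub2Text` ∕ `Stub3Text` (LINE 1) BY NAME feeds the route decl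
# `StabilityBRunRowsAtRecordR13SepCoPHVAx` through ONE `exact` below; the registered kit (`K1Skeleton13SepCoPHAxV11_1.lean` 1c0150ff21ca0f8d (v11.1, registered 2026-08-31T05:52:57Z)) keeps the `sorry` stubs and the audited concluders

R134 seat `pub-ymgap-dag-n24-c` (g23 pen, g24 re-stamp to v11.1; -a hand on LINE 2′'s three stubs per `K1AX-V11-LINE-TABLE.md` v3), `--kind definition --supports stmt-QuantumFields-27239 --as helper` (count-neutral; six `def … : Prop`
= the kit's stub signatures :234 ∕ :261 ∕ :315 ∕ :508 ∕ :516 ∕ :523 VERBATIM over the mirrored rungs; two theorems = the kit's `k1R9_of_stubsVW` ∕ `k1R9_of_stubs` read at the route decl BY NAME).  Imports the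
route file (the concluders' TYPE is the route decl literally); the Defs ∕ Roads mirrors do not.

HONEST FRAMING.  Naming only; NO stub proved or claimed; the concluders are CONDITIONAL on the three texts of a line (audit `proof.conditional`); K1ᴬ OPEN (v11 0∕6, never summed across lines);
counts UNMOVED (typed 28∕28 · discharged 8∕27, A 8∕28).  One finite 𝕋⁴ programme at fixed `ε` — NOT continuum ∕ ℝ⁴ ∕ OS ∕ mass gap ∕ Clay.  No `sorry`, `instance`, `notation`; standard axioms.  Locators of the six texts are given in prose, not as `[cite:]` tags (a tagged parameterless `def … : Prop` under Theorems∕ is relocated to Literature∕ by the gate).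
-/

set_option autoImplicit false

noncomputable section

namespace Summit.QuantumFields.YangMills.Theorems.K1AxV11StubTexts

open Literature.MathematicalPhysics.QuantumFieldTheory.Balaban1983to89
open Literature.MathematicalPhysics.QuantumFieldTheory.Balaban1983to89.T4Continuum
open Summit.QuantumFields.YangMills.Theorems.K1AxV11Defs

/-! ## §1. LINE 2′ (VW) — staffed first (dag-lead WORDS 645 ∕ 646) -/

/-- **STUB 1ⱽᵂ's TEXT** (kit :508 `stub_nodes13PWSVW`, XL): the thirteen DAG nodes at SOME revised Stage-13 record, window-guarded, N08 and N12 pinned by name.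
(Balaban1989LargeFieldII, Thm 1 p.355, (0.1) pp.355–356; Balaban1988Convergent, Cor. 3 (2.50) p.264 (statement shapes); bookkeeping) -/
def Stub1TextVW : Prop := ∀ F : T4Family, Inhabited13 F → NodesAtSomeRecord13PWSVW F

/-- **STUB 2ⱽᵂ's TEXT** (kit :516 `stub_runRows13PWSVW`, L): the run rows (i)–(iv) of `β_θ` at some rung-1ⱽᵂ witness. (Balaban1987RG1, Thm 3 p.264, (1.20)–(1.22) p.264, (5.10) p.293 (statement shapes); bookkeeping) -/
def Stub2TextVW : Prop := ∀ F : T4Family, NodesAtSomeRecord13PWSVW F → RunRowsAtSomeRecord13PWSVW F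

/-- **STUB 3ⱽᵂ's TEXT** (kit :523 `stub_cont13VW`, M–L): (C) run-wise survivor continuity at the rows witness. (Balaban1987RG1, §1 pp.263–264 (statement shape only); bookkeeping) -/
def Stub3TextVW : Prop := ∀ F : T4Family, RunRowsAtSomeRecord13PWSVW F → RunRowsContAtSomeRecord13PWSVW F

/-- ★ **K1ᴬ BY ITS ROUTE NAME FROM LINE 2′'s THREE TEXTS** — the kit's R1W composition `k1R9_of_stubsVW` (mirrored in `…K1AxV11Roads`) read at the route decl (its TYPE is
`Summit.QuantumFields.YangMills.Theses.BalabanUVNodes.StabilityBRunRowsAtRecordR13SepCoPHVAx` literally; the item's text and the decl agree by `δ`).  CONDITIONAL on the three texts; closes nothing.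
[cite: Balaban1989LargeFieldII, Thm 1 p.355 + (0.1) pp.355–356; Balaban1987RG1, Thm 3 p.264 (bookkeeping)] -/
theorem stabilityBRunRowsAtRecordR13SepCoPHVAx_of_stubTextsVW (h₁ : Stub1TextVW) (h₂ : Stub2TextVW) (h₃ : Stub3TextVW) :
    Summit.QuantumFields.YangMills.Theses.BalabanUVNodes.StabilityBRunRowsAtRecordR13SepCoPHVAx :=
  k1R9_of_stubsVW h₁ h₂ h₃

/-! ## §2. LINE 1 (PWS) — second priority; its rung results feed LINE 2′ through the mirrored doors -/

/-- **STUB 1's TEXT** (kit :234 `stub_nodes13PWS`, XL). (Balaban1989LargeFieldII, Thm 1 p.355, (0.1) pp.355–356 (statement shapes); bookkeeping) -/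
def Stub1Text : Prop := ∀ F : T4Family, Inhabited13 F → NodesAtSomeRecord13PWS F

/-- **STUB 2″'s TEXT** (kit :261 `stub_runRows13PWS`, L). (Balaban1987RG1, Thm 3 p.264, (1.20)–(1.22) p.264 (statement shapes); bookkeeping) -/
def Stub2Text : Prop := ∀ F : T4Family, NodesAtSomeRecord13PWS F → RunRowsAtSomeRecord13PWS F

/-- **STUB 3's TEXT** (kit :315 `stub_cont13`, M–L). (Balaban1987RG1, §1 pp.263–264 (statement shape only); bookkeeping) -/
def Stub3Text : Prop := ∀ F : T4Family, RunRowsAtSomeRecord13PWS F → RunRowsContAtSomeRecord13PWS F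

/-- ★ **K1ᴬ BY ITS ROUTE NAME FROM LINE 1's THREE TEXTS** — the kit's `k1R9_of_stubs` (slot filled by `Revision₁₃Ax.refl`) read at the route decl.  CONDITIONAL; closes nothing.
[cite: Balaban1989LargeFieldII, Thm 1 p.355 + (0.1) pp.355–356; Balaban1987RG1, Thm 3 p.264 (bookkeeping)] -/
theorem stabilityBRunRowsAtRecordR13SepCoPHVAx_of_stubTexts (h₁ : Stub1Text) (h₂ : Stub2Text) (h₃ : Stub3Text) :
    Summit.QuantumFields.YangMills.Theses.BalabanUVNodes.StabilityBRunRowsAtRecordR13SepCoPHVAx :=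
  k1R9_of_stubs h₁ h₂ h₃

/-- LINE 1's texts feed LINE 2′'s (the `refl` door then the window door, kit :497 ∕ :482): a LINE-1 stub 1 proof IS a LINE-2′ stub 1 proof. -/
theorem stub1TextVW_of_stub1Text (h₁ : Stub1Text) : Stub1TextVW := fun F hF => nodesAtSomeRecord13PWSVW_of_line1 (h₁ F hF)

end Summit.QuantumFields.YangMills.Theorems.K1AxV11StubTexts

end
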